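import Summits.FinalStateConjecture.FinalStateConjecture.Theses.BondiDrainDispersal

/-!
# cstrat-s11 census sketch — typed decomposition attempts for `HorizonlessMustDrain`

Scratch file of the second independent strategy census (family s, seat s11). Nothing here is
filed; it only certifies that the splits discussed in `STRATEGY-CENSUS-s11.md` are typable over
existing declarations and that their assemblies are pure logic.
-/

noncomputable section

open scoped Manifold Topology
open Filter Set Literature.Geometry.Lorentzian

namespace Summit.FinalStateConjecture.FinalStateConjecture.Cruxes.HorizonlessMustDrain.CensusS11

/-- The three hypotheses of the crux on one development: maximal, complete 𝓘⁺ (sojourn form),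
horizonless (ray-theoretic: no event invisible from the far ends of all complete rays). -/
def CruxHyp {X : Type} [TopologicalSpace X] [ChartedSpace E3 X]
    [IsManifold (𝓡 3) ((⊤ : ℕ∞) : WithTop ℕ∞) X] [ConnectedSpace X]
    {D : InitialDataSet (𝓡 3) X} (𝒟 : VacuumCauchyDevelopment D) : Prop :=
  𝒟.IsMaximal ∧ Summit.FinalStateConjecture.HasCompleteNullInfinity 𝒟.toCauchyDevelopment ∧
    ¬ (∀ [𝒟.metric.HasLeviCivita], ∃ q : 𝒟.carrier, ∀ (p : X) (γ : ℝ → 𝒟.carrier) (dom : Set ℝ),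
        𝒟.metric.IsNormalisedNullRayFrom 𝒟.timeOrientation 𝒟.embed 𝒟.normal p γ dom →
          ¬ BddAbove dom →
            q ∉ 𝒟.metric.chronologicalPast 𝒟.timeOrientation (γ '' (dom ∩ Set.Ici 0)))

/-! ## Split (A): Bondi mass exists on every cut (far field) + its infimum over cuts is zero -/

/-- (A1) Far-field piece: under the crux hypotheses every cut `𝓘⁺ ∩ ∂J⁺(K)`, `K` compact, carries
a (non-negative) Bondi energy measured by some asymptotically round receding family. -/
def LateCutsHaveBondiMass : Prop :=
  ∀ (X : Type) [TopologicalSpace X] [ChartedSpace E3 X]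
    [IsManifold (𝓡 3) ((⊤ : ℕ∞) : WithTop ℕ∞) X] [T2Space X] [SecondCountableTopology X]
    [ConnectedSpace X], ∀ D ∈ admissibleVacuumData X, ∀ 𝒟 : VacuumCauchyDevelopment D,
    CruxHyp 𝒟 → ∀ K : Set 𝒟.carrier, IsCompact K →
      ∃ m : ℝ, 0 ≤ m ∧ 𝒟.toCauchyDevelopment.HasCutBondiMass K m

/-- (A2) No-soliton piece in cut-mass currency: if every compact `K` has a cut with a Bondi
energy, then cuts of arbitrarily small Bondi energy exist. -/
def InfCutMassZero : Prop :=
  ∀ (X : Type) [TopologicalSpace X] [ChartedSpace E3 X]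
    [IsManifold (𝓡 3) ((⊤ : ℕ∞) : WithTop ℕ∞) X] [T2Space X] [SecondCountableTopology X]
    [ConnectedSpace X], ∀ D ∈ admissibleVacuumData X, ∀ 𝒟 : VacuumCauchyDevelopment D,
    CruxHyp 𝒟 →
      (∀ K : Set 𝒟.carrier, IsCompact K → ∃ m : ℝ, 0 ≤ m ∧ 𝒟.toCauchyDevelopment.HasCutBondiMass K m) →
        ∀ ε > (0 : ℝ), ∃ K : Set 𝒟.carrier, IsCompact K ∧
          ∃ m < ε, 𝒟.toCauchyDevelopment.HasCutBondiMass K m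

/-- Assembly of split (A): pure logic plus `hasVanishingFinalBondiMass_of_forall_exists_lt`. -/
theorem horizonlessMustDrain_of_A (hA1 : LateCutsHaveBondiMass) (hA2 : InfCutMassZero) :
    Theses.BondiDrainDispersal.HorizonlessMustDrain := by
  intro X _ _ _ _ _ _ D hD 𝒟 h𝒟 hI hH
  have hhyp : CruxHyp 𝒟 := ⟨h𝒟, hI, hH⟩
  exact CauchyDevelopment.hasVanishingFinalBondiMass_of_forall_exists_lt
    (hA2 X D hD 𝒟 hhyp (hA1 X D hD 𝒟 hhyp))

/-! ## Split (B): LaSalle — a non-draining development yields an eternal non-radiating one -/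

/-- A development is **non-radiating with mass `m`**: every cut has Bondi energy `m` and no
smaller one (constant Bondi mass along all of `𝓘⁺`). -/
def IsNonRadiatingWithMass {X : Type} [TopologicalSpace X] [ChartedSpace E3 X]
    [IsManifold (𝓡 3) ((⊤ : ℕ∞) : WithTop ℕ∞) X] [ConnectedSpace X]
    {D : InitialDataSet (𝓡 3) X} (𝒟 : VacuumCauchyDevelopment D) (m : ℝ) : Prop :=
  ∀ K : Set 𝒟.carrier, IsCompact K → (K ∩ range 𝒟.embed).Nonempty →
    𝒟.toCauchyDevelopment.HasCutBondiMass K m ∧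
      ∀ m', 𝒟.toCauchyDevelopment.HasCutBondiMass K m' → m ≤ m'

/-- (B1) Compactness / limit-object piece: a censored horizonless maximal development whose final
Bondi mass does not vanish produces SOME censored horizonless maximal development (of some
admissible datum on some data manifold) which is non-radiating with a positive mass. -/
def NonDrainingLimitObject : Prop :=
  ∀ (X : Type) [TopologicalSpace X] [ChartedSpace E3 X]
    [IsManifold (𝓡 3) ((⊤ : ℕ∞) : WithTop ℕ∞) X] [T2Space X] [SecondCountableTopology X]
    [ConnectedSpace X], ∀ D ∈ admissibleVacuumData X, ∀ 𝒟 : VacuumCauchyDevelopment D,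
    CruxHyp 𝒟 → ¬ 𝒟.toCauchyDevelopment.HasVanishingFinalBondiMass →
      ∃ (X' : Type) (_ : TopologicalSpace X') (_ : ChartedSpace E3 X')
        (_ : IsManifold (𝓡 3) ((⊤ : ℕ∞) : WithTop ℕ∞) X') (_ : T2Space X')
        (_ : SecondCountableTopology X') (_ : ConnectedSpace X')
        (D' : InitialDataSet (𝓡 3) X') (_ : D' ∈ admissibleVacuumData X')
        (𝒟' : VacuumCauchyDevelopment D'),
        CruxHyp 𝒟' ∧ ∃ m > (0 : ℝ), IsNonRadiatingWithMass 𝒟' m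

/-- (B2) One-sided Liouville piece: a censored horizonless maximal vacuum development which is
non-radiating along ALL of `𝓘⁺` has mass `≤ 0`. -/
def NonRadiatingHorizonlessMassless : Prop :=
  ∀ (X : Type) [TopologicalSpace X] [ChartedSpace E3 X]
    [IsManifold (𝓡 3) ((⊤ : ℕ∞) : WithTop ℕ∞) X] [T2Space X] [SecondCountableTopology X]
    [ConnectedSpace X], ∀ D ∈ admissibleVacuumData X, ∀ 𝒟 : VacuumCauchyDevelopment D,
    CruxHyp 𝒟 → ∀ m : ℝ, IsNonRadiatingWithMass 𝒟 m → m ≤ 0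

/-- Assembly of split (B): pure logic (`by_contra`). -/
theorem horizonlessMustDrain_of_B (hB1 : NonDrainingLimitObject)
    (hB2 : NonRadiatingHorizonlessMassless) :
    Theses.BondiDrainDispersal.HorizonlessMustDrain := by
  intro X _ _ _ _ _ _ D hD 𝒟 h𝒟 hI hH
  by_contra hnd
  obtain ⟨X', _, _, _, _, _, _, D', hD', 𝒟', hhyp', m, hm, hnr⟩ :=
    hB1 X D hD 𝒟 ⟨h𝒟, hI, hH⟩ hnd
  have := hB2 X' D' hD' 𝒟' hhyp' m hnr
  linarith

end Summit.FinalStateConjecture.FinalStateConjecture.Cruxes.HorizonlessMustDrain.CensusS11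

end
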